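import Mathlib
import Summits.NavierStokesRegularity.FluidComputer.AbcClassIIEigenpairUniqueClassII
import Summits.NavierStokesRegularity.FluidComputer.AbcClassIIEigenpairRow5002C
import Summits.NavierStokesRegularity.FluidComputer.CertificateAbcSpectrumThirdChain2
import Summits.NavierStokesRegularity.FluidComputer.AbcLyapunovInstability

/-!
# T3 ROW `Row5002C` (R = 500, class II, implementation 3) AS «EXACTLY ONE CLASS-II EIGENVALUE IN THE ISOLATION
# BALL» (profile-cert-3 g8, 2026-08-27)
HONEST FRAMING (D-0035/D-0074): not a claim about Navier–Stokes blow-up. WHAT THIS IS NOT: not NS evidence;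
MODEL lane (NS linearised about `abcFlow 1 1 1` at viscosity `1/(2π·500)`, class II); no certificate, number or
census word moves; CONDITIONAL on the row's transcribed facts (as `AbcClassIIEigenpairRow5002CComplex`), in the
certifier's own COMPLEX orbit basis (AUDIT-BASIS-ℂ j268037 PASSED for implementation 3).
**`row5002C_unique_classII_eigenvalue_of_complex_bases`**: the row's facts ⇒ there is `λ⋆` with
`|λ⋆ − λ̃| ≤ Row5002C.rho`, REAL, `Re λ⋆ > 0`, `Torus.IsLinNSEigenvalue (1/(2π·500)) (abcFlow 1 1 1) (2πλ⋆)`, and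
EVERY classical eigenpair `(z, u)` of that linearisation with `u ≠ 0` and CLASS-II Fourier coefficients and
`|z − λ⋆| < Row5002C.rIso` has `z = λ⋆` (the (D7) form of ISOLATION, `eq_of_classII_eigenfunction_of_isolated`),
and (+ FPS06) rung R-α. The closings are those of `AbcClassIIEigenpairRow5002CComplex` repeated. Mathlib + the
files named; no new definitions. bears_on LADDER-NS N5 / Z4-a(1) (T3), N1* R-α.
-/

noncomputable section

open scoped BigOperators ComplexConjugate InnerProductSpace
open Finset MeasureTheory UnitAddTorus

namespace Summit.NavierStokesRegularity.FluidComputer.AbcClassIIEigenpair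

open Literature.Analysis.FunctionSpaces Literature.Analysis.FunctionSpaces.Torus
open Literature.Analysis.FluidPDE
open Summit.NavierStokesRegularity.FluidComputer.AbcClassII
open Summit.NavierStokesRegularity.FluidComputer.CertificateAbcSpectrum

section Row

variable (wf : Idx → Fam)
variable (hws : ∀ i : Idx, ∀ k ∉ i.1.1, wf i k = 0)
variable (hwt : ∀ (i : Idx) (k : Fin 3 → ℤ), ∑ j : Fin 3, ((k j : ℤ) : ℂ) * wf i k j = 0)
variable (hwII : ∀ i : Idx, IsClassII (wf i))
variable (hwon : ∀ (O : Orbit) (a b : Fin (odim O)),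
  ∑ k ∈ O.1, (inner ℂ (wf ⟨O, a⟩ k) (wf ⟨O, b⟩ k) : ℂ) = if a = b then 1 else 0)
variable (amc : Idx → Idx → ℂ)
variable (hamc : ∀ i j : Idx, amc i j =
  ∑ k ∈ i.1.1, (inner ℂ (wf i k) (Torus.lerayCoeff k (crossForm 1 1 1 (wf j) k)) : ℂ))

include hws hwt hwII hwon hamc in
/-- **Row5002C (T1: R = 500, class II, implementation 3) ⇒ a certified, real, unstable, isolated eigenvalue of
`L₃₀₀|II` and rung R-α**, CONDITIONAL on the row's transcribed facts in the certifier's own COMPLEX orbit basis. -/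
theorem row5002C_unique_classII_eigenvalue_of_complex_bases
    (vt : Idx → ℂ) (hvt0 : ∀ i, i ∉ cubeIdx 112 → vt i = 0)
    (hres : ∑ i ∈ cubeIdx 112 ∪ (cubeIdx 112).biUnion nbrIdx,
      ‖(if i ∈ cubeIdx 112 then ((((Row5002C.lamRe : ℚ) : ℝ) : ℂ) - ((-(onormSq i.1 / 500) : ℝ) : ℂ)) * vt i
          else 0) - ∑ j ∈ cubeIdx 112, amc i j * vt j‖ ^ 2 ≤ ((Row5002C.rnorm : ℚ) : ℝ) ^ 2)
    (hntb : ∑ i ∈ cubeIdx 112 \ cubeIdx 28, ‖vt i‖ ^ 2 ≤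
      (((1292560462104437 : ℚ) / 144115188075855872 : ℚ) : ℝ) ^ 2)
    (Binv : ((↥(cubeIdx 28) → ℂ) × ℂ) →ₗ[ℂ] ((↥(cubeIdx 28) → ℂ) × ℂ))
    (hBinv : ∀ (c : ↥(cubeIdx 28) → ℂ) (m : ℂ),
      Binv (fun i : ↥(cubeIdx 28) =>
          ((((Row5002C.lamRe : ℚ) : ℝ) : ℂ) - ((-(onormSq i.1.1 / 500) : ℝ) : ℂ)) * c i -
          ∑ j : ↥(cubeIdx 28), amc i j * c j + m * vt i,
        ∑ i : ↥(cubeIdx 28), conj (vt i) * c i) = (c, m))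
    (hαM : ∀ (c : ↥(cubeIdx 28) → ℂ) (g : ℂ),
      ∑ j : ↥(cubeIdx 28), ‖(Binv (c, g)).1 j‖ ^ 2 + ‖(Binv (c, g)).2‖ ^ 2 ≤
        ((Row5002C.alpha0 : ℚ) : ℝ) ^ 2 * (∑ i : ↥(cubeIdx 28), ‖c i‖ ^ 2 + ‖g‖ ^ 2))
    (hβBM : ∀ w : Idx → ℂ,
      ∑ j : ↥(cubeIdx 28), ‖(Binv (fun i : ↥(cubeIdx 28) => -∑ j ∈ nbrIdx i \ cubeIdx 28,
          amc i j * w j, 0)).1 j‖ ^ 2 +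
        ‖(Binv (fun i : ↥(cubeIdx 28) => -∑ j ∈ nbrIdx i \ cubeIdx 28,
          amc i j * w j, 0)).2‖ ^ 2 ≤
        ((Row5002C.betaB : ℚ) : ℝ) ^ 2 * ∑ j ∈ (cubeIdx 28).biUnion nbrIdx \ cubeIdx 28, ‖w j‖ ^ 2)
    (hβCM : ∀ (c : ↥(cubeIdx 28) → ℂ) (g : ℂ),
      ∑ i ∈ ((cubeIdx 28).biUnion nbrIdx ∪ cubeIdx 112) \ cubeIdx 28,
        ‖-∑ j : ↥(cubeIdx 28), amc i j * (Binv (c, g)).1 j +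
          (Binv (c, g)).2 * vt i‖ ^ 2 ≤
        ((Row5002C.betaC : ℚ) : ℝ) ^ 2 * (∑ i : ↥(cubeIdx 28), ‖c i‖ ^ 2 + ‖g‖ ^ 2))
    (hgBM : ∀ w : Idx → ℂ,
      ‖(Binv (fun i : ↥(cubeIdx 28) => ∑ j ∈ nbrIdx i \ cubeIdx 28,
          amc i j * w j, 0)).2‖ ^ 2 ≤
        (((2198037866660847 : ℚ) / 562949953421312 : ℚ) : ℝ) ^ 2 *
          ∑ j ∈ (cubeIdx 28).biUnion nbrIdx \ cubeIdx 28, ‖w j‖ ^ 2)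
    (hshellM : ∀ w : Idx → ℂ, (∀ i ∈ cubeIdx 28, w i = 0) →
      (((628200374963231 : ℚ) / 1125899906842624 : ℚ) : ℝ) * ∑ i ∈ cubeIdx (28 + 1) \ cubeIdx 28, ‖w i‖ ^ 2 ≤
        ∑ i ∈ cubeIdx (28 + 1) \ cubeIdx 28,
          ((((Row5002C.lamRe : ℚ) : ℝ) : ℂ).re - (-(onormSq i.1 / 500)) - Real.sqrt 2) * ‖w i‖ ^ 2 -
        RCLike.re (∑ i ∈ (cubeIdx 28).biUnion nbrIdx \ cubeIdx 28,
          conj (∑ j : ↥(cubeIdx 28), amc i j *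
            (Binv (fun i : ↥(cubeIdx 28) => ∑ j ∈ nbrIdx i \ cubeIdx 28,
              amc i j * w j, 0)).1 j) * w i)) :
    ∃ lam : ℂ, ‖lam - (((Row5002C.lamRe : ℚ) : ℝ) : ℂ)‖ ≤ ((Row5002C.rho : ℚ) : ℝ) ∧ lam.im = 0 ∧
      0 < lam.re ∧
      Torus.IsLinNSEigenvalue (1 / (2 * Real.pi * 500)) (Torus.abcFlow 1 1 1) (2 * Real.pi * lam) ∧
      (∀ (z : ℂ) (u : UnitAddTorus (Fin 3) → EuclideanSpace ℂ (Fin 3)),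
        Torus.LinNSResolventRel (1 / (2 * Real.pi * 500)) (Torus.abcFlow 1 1 1) (2 * Real.pi * z) u 0 → u ≠ 0 →
          IsClassII (mFourierCoeff u) → ‖z - lam‖ < ((Row5002C.rIso : ℚ) : ℝ) → z = lam) ∧
      (Torus.fps2006_nonlinear_instability_of_eigenvalue →
        Torus.IsLyapunovUnstableSteadyState (1 / (2 * Real.pi * 500))
          (fun x => (4 * Real.pi ^ 2 * (1 / (2 * Real.pi * 500))) • Torus.abcFlow 1 1 1 x)
          (Torus.abcFlow 1 1 1)) := by
  -- the row's constants
  set lt : ℂ := (((Row5002C.lamRe : ℚ) : ℝ) : ℂ) with hlt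
  set α : ℝ := ((Row5002C.alpha0 : ℚ) : ℝ) with hαdef
  set βB : ℝ := ((Row5002C.betaB : ℚ) : ℝ) with hβBdef
  set βC : ℝ := ((Row5002C.betaC : ℚ) : ℝ) with hβCdef
  set gB : ℝ := (((2198037866660847 : ℚ) / 562949953421312 : ℚ) : ℝ) with hgBdef
  set nt : ℝ := (((1292560462104437 : ℚ) / 144115188075855872 : ℚ) : ℝ) with hntdef
  set MU2 : ℝ := (((628200374963231 : ℚ) / 1125899906842624 : ℚ) : ℝ) with hMU2def
  set r₀ : ℝ := ((Row5002C.rnorm : ℚ) : ℝ) with hr₀def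
  set μ : ℝ := MU2 - gB * nt with hμdef
  set M : ℝ := √((1 + βC ^ 2) / μ ^ 2 + (α + βB * √(1 + βC ^ 2) / μ) ^ 2) with hMdef
  have hlt_re : lt.re = ((Row5002C.lamRe : ℚ) : ℝ) := by rw [hlt, Complex.ofReal_re]
  have hlt_im : lt.im = 0 := by rw [hlt, Complex.ofReal_im]
  have hα0 : 0 ≤ α := by rw [hαdef]; exact_mod_cast (by norm_num [Row5002C.alpha0] : (0 : ℚ) ≤ Row5002C.alpha0)
  have hβB0 : 0 ≤ βB := by rw [hβBdef]; exact_mod_cast (by norm_num [Row5002C.betaB] : (0 : ℚ) ≤ Row5002C.betaB)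
  have hβC0 : 0 ≤ βC := by rw [hβCdef]; exact_mod_cast (by norm_num [Row5002C.betaC] : (0 : ℚ) ≤ Row5002C.betaC)
  have hgB0 : 0 ≤ gB := by rw [hgBdef]; exact_mod_cast (by norm_num : (0 : ℚ) ≤ 2198037866660847 / 562949953421312)
  have hnt0 : 0 ≤ nt := by rw [hntdef]; exact_mod_cast (by norm_num : (0 : ℚ) ≤ 1292560462104437 / 144115188075855872)
  have hr₀0 : 0 ≤ r₀ := by rw [hr₀def]; exact_mod_cast (by norm_num [Row5002C.rnorm] : (0 : ℚ) ≤ Row5002C.rnorm)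
  -- the printed `μ_eff` is below the exact `MU2 − gB·nt`, and positive
  have hmuμ : ((Row5002C.mu : ℚ) : ℝ) ≤ μ := by
    rw [hμdef, hMU2def, hgBdef, hntdef]
    exact_mod_cast (by norm_num [Row5002C.mu] :
      Row5002C.mu ≤ (628200374963231 : ℚ) / 1125899906842624 -
        2198037866660847 / 562949953421312 * (1292560462104437 / 144115188075855872))
  have hmu0 : 0 < ((Row5002C.mu : ℚ) : ℝ) := by exact_mod_cast Row5002C.mu_pos
  have hμ : 0 < μ := lt_of_lt_of_le hmu0 hmuμ
  -- `M ≤ B := backSubstConst α₀ μ_eff β_B β_C′ ≤ M0` and the chain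
  have hMB : M ≤ backSubstConst Row5002C.alpha0 Row5002C.mu Row5002C.betaB Row5002C.betaC := by
    rw [hMdef, backSubstConst, hαdef, hβBdef, hβCdef]
    exact backSubst_anti hα0 hβB0 hmu0 hmuμ
  obtain ⟨-, hBρ, hBκ, hBiso⟩ := Row5002C.chain_real
  have hB0 : 0 < backSubstConst Row5002C.alpha0 Row5002C.mu Row5002C.betaB Row5002C.betaC := by
    rw [backSubstConst]
    refine Real.sqrt_pos.mpr (add_pos_of_pos_of_nonneg ?_ (sq_nonneg _))
    have : 0 < ((Row5002C.mu : ℚ) : ℝ) := hmu0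
    positivity
  have hM0 : 0 ≤ M := by rw [hMdef]; exact Real.sqrt_nonneg _
  have hκ1 : ((Row5002C.kappa : ℚ) : ℝ) < 1 := by exact_mod_cast Row5002C.kappa_lt_one
  have hκM : 2 * Real.sqrt 2 * M ^ 2 * r₀ ≤ ((Row5002C.kappa : ℚ) : ℝ) := by
    refine le_trans ?_ hBκ
    have : M ^ 2 ≤ backSubstConst Row5002C.alpha0 Row5002C.mu Row5002C.betaB Row5002C.betaC ^ 2 :=
      pow_le_pow_left₀ hM0 hMB 2
    have h2 : 0 ≤ 2 * Real.sqrt 2 := by positivity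
    exact mul_le_mul_of_nonneg_right (mul_le_mul_of_nonneg_left this h2) hr₀0
  have hκ : 2 * Real.sqrt 2 * M ^ 2 * r₀ < 1 := lt_of_le_of_lt hκM hκ1
  have hρ : 2 * M * r₀ ≤ ((Row5002C.rho : ℚ) : ℝ) := by
    refine le_trans ?_ hBρ
    exact mul_le_mul_of_nonneg_right (mul_le_mul_of_nonneg_left hMB zero_le_two) hr₀0
  have hiso : ((Row5002C.rIso : ℚ) : ℝ) ≤ (1 - 2 * Real.sqrt 2 * M ^ 2 * r₀) / M := by
    have hMpos : 0 < M := by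
      rw [hMdef]
      exact Real.sqrt_pos.mpr (add_pos_of_pos_of_nonneg (div_pos (by positivity) (pow_pos hμ 2)) (sq_nonneg _))
    calc ((Row5002C.rIso : ℚ) : ℝ)
        ≤ (1 - ((Row5002C.kappa : ℚ) : ℝ)) /
            backSubstConst Row5002C.alpha0 Row5002C.mu Row5002C.betaB Row5002C.betaC := hBiso
      _ ≤ (1 - 2 * Real.sqrt 2 * M ^ 2 * r₀) /
            backSubstConst Row5002C.alpha0 Row5002C.mu Row5002C.betaB Row5002C.betaC :=
          div_le_div_of_nonneg_right (by linarith) hB0.le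
      _ ≤ (1 - 2 * Real.sqrt 2 * M ^ 2 * r₀) / M :=
          div_le_div_of_nonneg_left (by linarith) hMpos hMB
  have h2ρ : 2 * (2 * M * r₀) < (1 - 2 * Real.sqrt 2 * M ^ 2 * r₀) / M := by
    have hreal : 2 * ((Row5002C.rho : ℚ) : ℝ) < ((Row5002C.rIso : ℚ) : ℝ) := by
      exact_mod_cast Row5002C.real.2
    linarith
  -- the tail constant: `MU2 ≤ Re λ̃ + (K₀+2)²/R − √2`
  have hs : Real.sqrt 2 < 1.41422 := (Real.sqrt_lt' (by norm_num)).mpr (by norm_num)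
  have htailK : MU2 ≤ lt.re + ((28 : ℝ) + 2) ^ 2 / 500 - Real.sqrt 2 := by
    rw [hlt_re, hMU2def]
    have : (((628200374963231 : ℚ) / 1125899906842624 : ℚ) : ℝ) + 1.41422 ≤
        ((Row5002C.lamRe : ℚ) : ℝ) + ((28 : ℝ) + 2) ^ 2 / 500 := by
      have h := (by norm_num [Row5002C.lamRe] :
        (628200374963231 : ℚ) / 1125899906842624 + 141422 / 100000 ≤ Row5002C.lamRe + (28 + 2) ^ 2 / 500)
      have h' : (((628200374963231 : ℚ) / 1125899906842624 + 141422 / 100000 : ℚ) : ℝ) ≤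
          ((Row5002C.lamRe + (28 + 2) ^ 2 / 500 : ℚ) : ℝ) := by exact_mod_cast h
      push_cast at h'
      linarith
    linarith
  -- the general theorem in its (D7) form
  obtain ⟨lam, hclose, heig, huniq, hreal⟩ :=
    unique_classII_eigenvalue_of_nested_certificate wf hws hwt hwII hwon amc hamc (R := 500) (by norm_num) 28 112 lt
      vt hvt0 hr₀0 hnt0 hres hntb Binv hBinv hα0 hβB0 hβC0 hgB0 hαM hβBM hβCM hgBM hshellM htailK hμdef hμ
      hMdef hκ
  have hclose' : ‖lam - lt‖ ≤ ((Row5002C.rho : ℚ) : ℝ) := hclose.trans hρ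
  have him : lam.im = 0 := hreal hlt_im h2ρ
  have hre : 0 < lam.re := by
    have h1 : |(lam - lt).re| ≤ ‖lam - lt‖ := Complex.abs_re_le_norm _
    rw [Complex.sub_re, hlt_re] at h1
    have h2 : 0 < ((Row5002C.lamRe : ℚ) : ℝ) - ((Row5002C.rho : ℚ) : ℝ) := by
      exact_mod_cast Row5002C.unstable
    have h3 := (abs_le.mp (h1.trans hclose')).1
    linarith
  refine ⟨lam, hclose', him, hre, heig, fun z u hu hu0 hII hz => huniq z u hu hu0 hII (lt_of_lt_of_le hz hiso),
    fun hFPS => ?_⟩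
  have hν : 0 < 1 / (2 * Real.pi * (500 : ℝ)) := by positivity
  have hμre : 0 < (2 * Real.pi * lam : ℂ).re := by
    have e1 : (2 * Real.pi * lam : ℂ).re = 2 * Real.pi * lam.re := by
      simp [Complex.mul_re, him]
    rw [e1]; positivity
  exact AbcLyapunovInstability.isLyapunovUnstable_abcFlow_of_eigenvalue hFPS hν 1 1 1 hμre heig

end Row

end Summit.NavierStokesRegularity.FluidComputer.AbcClassIIEigenpair

end
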